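import Literature.NumberTheory.ComplexMultiplication.GaloisCMFieldsPrimeDegreePair
import Literature.AlgebraicGeometry.Pohlmann1968.NondegenerateCMTypeHodgeConjecture
import Literature.AlgebraicGeometry.Pohlmann1968.SeparatingCMFamilies
import Summits.HodgeConjecture.CorCM.RealIntersectionCMFieldsHodge
import HarnessLib

/-!
# Two simple CM abelian varieties of the same odd prime dimension `p` with GALOIS CM fields: the Hodge conjecture on
# every `A₀^a × A₁^b`, or a forced exceptional Hodge class — decided by the single invariant `[L₀ ∩ L₁ : ℚ]`

COR-CM (cell `pub-hodgecm2`, binder seat `b23` gen 28), count-neutral; NEW as stated, hence under `Summits/`.  The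
geometric face of the literature file `Literature.NumberTheory.ComplexMultiplication.GaloisCMFieldsPrimeDegreePair` (this
seat): for two Galois CM fields `K_{i₀}`, `K_{i₁}` of degree `2p`, `p` an ODD PRIME, with different Galois closures
`L₀ ≠ L₁` in `ℂ`, the degree `d = [L₀ ∩ L₁ : ℚ]` lies in `{1, 2, p}`; `d ≠ 2` gives PARTIAL CONJUGATIONS at both slots,
`d = 2` makes `L₀ ∩ L₁` a shared IMAGINARY quadratic field and EVERY family of CM types degenerate.  On abelian varieties
(realisations `(A_i, ι_i, θ_i)` of CM types `Φ_i` on `H¹`; by Yanai's theorem `isNondegenerate_of_isPrimitive_of_prime`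
every primitive type in degree `2p` is nondegenerate, so SIMPLE factors are automatically nondegenerate):

* **`hodgeConjectureFor_prod_pair_of_prime_of_finrank_inf_ne_two`** — `d ≠ 2`, nondegenerate types: the Hodge
  conjecture for every `⨁_{j<N} A_{π j}` (every `A₀^a × A₁^b`), and `B• = D•` there
  (`hodgeClassSpan_prod_eq_divisorClassesSpan_pair_of_prime_of_finrank_inf_ne_two`); primitive-type form
  `hodgeConjectureFor_prod_pair_of_prime_of_isPrimitive`;
* **`exists_exceptional_prod_pair_of_prime_of_finrank_inf_eq_two`** — `d = 2`, separating family (simple, pairwise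
  non-isogenous factors): some `⨁_{j<N} A_{π j}` carries a rational `(m,m)`-class OUTSIDE `Dᵐ ⊗ ℂ` (a Weil class of the
  shared imaginary quadratic field);
* **`isNondegenerateFamily_iff_finrank_inf_ne_two_of_prime`**, **`forall_prod_hodgeClassSpan_eq_iff_finrank_inf_ne_two_of_prime`**,
  **`exists_exceptional_prod_iff_finrank_inf_eq_two_of_prime`** — THE DECIDING INVARIANT: for a separating family,
  `B• = D•` on all products ⟺ `d ≠ 2`, and an exceptional class exists on some product ⟺ `d = 2`;
* **`hodgeConjectureFor_prod_or_exists_exceptional_of_isSimple_of_prime`** — the packaged dichotomy for two SIMPLE,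
  NON-ISOGENOUS abelian varieties of dimension `p` with CM by NON-ISOMORPHIC Galois CM fields of degree `2p`
  (`normalClosure_ne_of_isEmpty_ringEquiv`: non-isomorphic Galois fields have different closures).

Examples: `p = 3`, cyclic sextic CM fields `k·C` (`k` imaginary quadratic, `C` cyclic cubic): `ℚ(ζ_7) = ℚ(√−7)·ℚ(ζ_7)⁺`
with `ℚ(√−3)·ℚ(ζ_7)⁺` share the REAL cubic `ℚ(ζ_7)⁺` (`d = 3`: Hodge conjecture on all `A₀^a × A₁^b`); `ℚ(ζ_7)` with
`ℚ(ζ_9) = ℚ(√−3)·ℚ(ζ_9)⁺` meet in `ℚ` (`d = 1`: same conclusion); `ℚ(ζ_7)` with `ℚ(√−7)·ℚ(ζ_9)⁺` share `ℚ(√−7)`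
(`d = 2`: an exceptional Hodge class on some `A₀^a × A₁^b`, not claimed algebraic or non-algebraic here).
Everything is a short application of the literature files; theorems only, no definition, no `sorry`.

## References

* [Gordon1999HodgeAVSurvey] B. B. Gordon, *A survey of the Hodge conjecture for abelian varieties*, §3 Theorem (proof),
  Thm. 6.3 and Remark, 7.4–7.7, 10.10.
* [Yanai1985] H. Yanai, *On the rank of CM-type*, Nagoya Math. J. 97 (1985), §4 Theorem.
* [Lang2002] S. Lang, *Algebra*, 3rd ed., GTM 211, V §3 Thm. 3.3, VI §1 Thm. 1.1 and Cor. 1.4.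
* [Deligne1982HodgeCycles] P. Deligne, *Hodge cycles on abelian varieties*, LNM 900 (1982), §4 (Weil classes).
-/

noncomputable section

open CategoryTheory CategoryTheory.Limits NumberField IntermediateField Module

namespace Summit.HodgeConjecture.CorCM

open Literature.NumberTheory.ComplexMultiplication
open Literature.AlgebraicGeometry.Motives (AbelianVariety CMType)
open Literature.AlgebraicGeometry.HodgeTheory
open Literature.AlgebraicGeometry.ComplexMultiplication (IsCMTypeRealisation)
open Literature.AlgebraicGeometry.VanGeemen1994 (hodgeClassSpan)
open Literature.AlgebraicGeometry.Pohlmann1968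
open Literature.Barriers.HodgeConjecture (divisorClassesSpan)

/-! ### Fields: non-isomorphic Galois number fields have different Galois closures in `ℂ` -/

section Fields

variable {I : Type} {K : I → Type} [∀ i, Field (K i)] [∀ i, NumberField (K i)]

/-- **Non-isomorphic Galois number fields have different Galois closures in `ℂ`**: the closure of a normal `K` is the
image `s(K) ≅ K` of any one embedding, so `L₀ = L₁` would give `K_{i₀} ≅ L₀ = L₁ ≅ K_{i₁}`.
[cite: Lang2002, V §3 Thm. 3.3 (NOR 2)] -/
theorem normalClosure_ne_of_isEmpty_ringEquiv {i₀ i₁ : I} [IsGalois ℚ (K i₀)] [IsGalois ℚ (K i₁)]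
    (hKK : IsEmpty (K i₀ ≃+* K i₁)) : normalClosure ℚ (K i₀) ℂ ≠ normalClosure ℚ (K i₁) ℂ := by
  intro h
  obtain ⟨s₀⟩ : Nonempty (K i₀ →+* ℂ) := inferInstance
  obtain ⟨s₁⟩ : Nonempty (K i₁ →+* ℂ) := inferInstance
  have h' : s₀.toRatAlgHom.fieldRange = s₁.toRatAlgHom.fieldRange := by
    rw [← normalClosure_eq_fieldRange_of_normal s₀.toRatAlgHom, ← normalClosure_eq_fieldRange_of_normal s₁.toRatAlgHom]
    exact h
  exact hKK.false (((AlgEquiv.ofInjectiveField s₀.toRatAlgHom).trans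
    ((IntermediateField.equivOfEq h').trans (AlgEquiv.ofInjectiveField s₁.toRatAlgHom).symm)).toRingEquiv)

end Fields

/-! ### Types: the deciding invariant `[L₀ ∩ L₁ : ℚ]` -/

section Types

variable {I : Type} {K : I → Type} [∀ i, Field (K i)] [∀ i, NumberField (K i)] [∀ i, IsCMField (K i)] [Fintype I]
  {Φ : ∀ i, CMType (K i)}

omit [Fintype I] in
/-- **The members of a separating family of CM types of CM fields of degree `2p` are nondegenerate**: separating ⟹ each
`Φ_i` primitive (Kubota), and primitive ⟹ nondegenerate in degree `2p` (Yanai). [cite: Yanai1985, §4 Theorem (p. 171)]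
[cite: Gordon1999HodgeAVSurvey, Thm. 6.3 Remark and 7.4] -/
theorem isNondegenerate_of_isSeparatingFamily_of_prime {p : ℕ} (hp : p.Prime) (hdeg : ∀ i, finrank ℚ (K i) = 2 * p)
    (hsep : CMAlgebra.IsSeparatingFamily Φ) (i : I) : IsNondegenerate (Φ i) := by
  obtain ⟨φ₀⟩ : Nonempty (K i →+* ℂ) := inferInstance
  exact isNondegenerate_of_isPrimitive_of_prime hp (hdeg i) φ₀ (hsep.isPrimitive i φ₀)

variable [Nonempty I]

/-- **The deciding invariant.**  Two Galois CM fields of degree `2p` (`p` odd prime) with different Galois closures and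
NONDEGENERATE types `Φ_{i₀}`, `Φ_{i₁}`: the family is nondegenerate (`rank Hg(A₀ × A₁) = rank Hg(A₀) + rank Hg(A₁)`,
stably no exceptional classes) **iff `[L₀ ∩ L₁ : ℚ] ≠ 2`** — `d ∈ {1, p}` gives partial conjugations, `d = 2` a shared
imaginary quadratic field. [cite: Gordon1999HodgeAVSurvey, §3 Theorem and 7.5–7.7] -/
theorem isNondegenerateFamily_iff_finrank_inf_ne_two_of_prime {p : ℕ} (hp : p.Prime) (hp2 : p ≠ 2) {i₀ i₁ : I}
    (h01 : i₀ ≠ i₁) (hI : ∀ j, j = i₀ ∨ j = i₁) [IsGalois ℚ (K i₀)] [IsGalois ℚ (K i₁)]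
    (h₀ : finrank ℚ (K i₀) = 2 * p) (h₁ : finrank ℚ (K i₁) = 2 * p)
    (hne : normalClosure ℚ (K i₀) ℂ ≠ normalClosure ℚ (K i₁) ℂ) (hΦ : ∀ i, IsNondegenerate (Φ i)) :
    CMAlgebra.IsNondegenerateFamily Φ ↔ finrank ℚ ↥(normalClosure ℚ (K i₀) ℂ ⊓ normalClosure ℚ (K i₁) ℂ) ≠ 2 :=
  ⟨fun hnd h2 => not_isNondegenerateFamily_of_prime_of_finrank_inf_eq_two hp hp2 h01 h₀ h₁ h2 Φ hnd, fun h2 =>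
    (isNondegenerateFamily_iff_of_partialConj
      (forall_exists_partialConj_pair_of_prime_of_finrank_inf_ne_two hp hp2 h01 hI h₀ h₁ hne h2) Φ).2 hΦ⟩

/-- **Additive rank when `[L₀ ∩ L₁ : ℚ] ≠ 2`**: `cmFamilyRank Φ + 2 = cmTypeRank Φ_{i₀} + cmTypeRank Φ_{i₁} + 1`
(`rank Hg(A₀ × A₁) = rank Hg(A₀) + rank Hg(A₁)`) for ALL types. [cite: Gordon1999HodgeAVSurvey, §3 Theorem (1)] -/
theorem cmFamilyRank_add_card_eq_pair_of_prime_of_finrank_inf_ne_two {p : ℕ} (hp : p.Prime) (hp2 : p ≠ 2)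
    {i₀ i₁ : I} (h01 : i₀ ≠ i₁) (hI : ∀ j, j = i₀ ∨ j = i₁) [IsGalois ℚ (K i₀)] [IsGalois ℚ (K i₁)]
    (h₀ : finrank ℚ (K i₀) = 2 * p) (h₁ : finrank ℚ (K i₁) = 2 * p)
    (hne : normalClosure ℚ (K i₀) ℂ ≠ normalClosure ℚ (K i₁) ℂ)
    (h2 : finrank ℚ ↥(normalClosure ℚ (K i₀) ℂ ⊓ normalClosure ℚ (K i₁) ℂ) ≠ 2) (Φ : ∀ i, CMType (K i)) :
    CMAlgebra.cmFamilyRank Φ + Fintype.card I = (∑ i, cmTypeRank (Φ i)) + 1 :=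
  cmFamilyRank_add_card_eq_of_partialConj
    (forall_exists_partialConj_pair_of_prime_of_finrank_inf_ne_two hp hp2 h01 hI h₀ h₁ hne h2) Φ

end Types

/-! ### Abelian varieties -/

section Geometry

variable {I : Type} {K : I → Type} [∀ i, Field (K i)] [∀ i, NumberField (K i)] [∀ i, IsCMField (K i)] [Fintype I]
  [Nonempty I] {Φ : ∀ i, CMType (K i)}
variable {A : I → AbelianVariety ℂ} {ι : ∀ i, 𝓞 (K i) →+* End (A i)}
  {θ : ∀ i, K i →+* Module.End ℂ (complexBetti (A i).X 1)}

/-- **`[L₀ ∩ L₁ : ℚ] ≠ 2`: the Hodge conjecture for every `A₀^a × A₁^b`** (every `⨁_{j<N} A_{π j}`) of realisations of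
nondegenerate CM types of two Galois CM fields of degree `2p`, `p` odd prime, with different Galois closures —
UNCONDITIONAL: both slots carry partial conjugations, the product is stably nondegenerate, every Hodge class is a
polynomial in divisor classes. [cite: Gordon1999HodgeAVSurvey, §3 Theorem and 10.10] -/
theorem hodgeConjectureFor_prod_pair_of_prime_of_finrank_inf_ne_two {p : ℕ} (hp : p.Prime) (hp2 : p ≠ 2)
    {i₀ i₁ : I} (h01 : i₀ ≠ i₁) (hI : ∀ j, j = i₀ ∨ j = i₁) [IsGalois ℚ (K i₀)] [IsGalois ℚ (K i₁)]
    (h₀ : finrank ℚ (K i₀) = 2 * p) (h₁ : finrank ℚ (K i₁) = 2 * p)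
    (hne : normalClosure ℚ (K i₀) ℂ ≠ normalClosure ℚ (K i₁) ℂ)
    (h2 : finrank ℚ ↥(normalClosure ℚ (K i₀) ℂ ⊓ normalClosure ℚ (K i₁) ℂ) ≠ 2)
    (hΦ : ∀ i, IsNondegenerate (Φ i)) (hA : ∀ i, IsCMTypeRealisation (Φ i) (A i) (ι i) (θ i)) {N : ℕ}
    (π : Fin N → I) :
    HodgeConjectureFor (⨁ fun j : Fin N => A (π j)).dim (⨁ fun j : Fin N => A (π j)).X :=
  hodgeConjectureFor_prod_of_partialConj
    (forall_exists_partialConj_pair_of_prime_of_finrank_inf_ne_two hp hp2 h01 hI h₀ h₁ hne h2) hΦ hA π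

/-- **`[L₀ ∩ L₁ : ℚ] ≠ 2`: `Bᵐ ⊗ ℂ = Dᵐ ⊗ ℂ` on every `A₀^a × A₁^b`** of realisations of nondegenerate types.
[cite: Gordon1999HodgeAVSurvey, §3 Theorem (2) and 7.5] -/
theorem hodgeClassSpan_prod_eq_divisorClassesSpan_pair_of_prime_of_finrank_inf_ne_two {p : ℕ} (hp : p.Prime)
    (hp2 : p ≠ 2) {i₀ i₁ : I} (h01 : i₀ ≠ i₁) (hI : ∀ j, j = i₀ ∨ j = i₁) [IsGalois ℚ (K i₀)] [IsGalois ℚ (K i₁)]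
    (h₀ : finrank ℚ (K i₀) = 2 * p) (h₁ : finrank ℚ (K i₁) = 2 * p)
    (hne : normalClosure ℚ (K i₀) ℂ ≠ normalClosure ℚ (K i₁) ℂ)
    (h2 : finrank ℚ ↥(normalClosure ℚ (K i₀) ℂ ⊓ normalClosure ℚ (K i₁) ℂ) ≠ 2)
    (hΦ : ∀ i, IsNondegenerate (Φ i)) (hA : ∀ i, IsCMTypeRealisation (Φ i) (A i) (ι i) (θ i)) {N : ℕ}
    (π : Fin N → I) (m : ℕ) :
    hodgeClassSpan (⨁ fun j : Fin N => A (π j)).dim (⨁ fun j : Fin N => A (π j)).X m =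
      divisorClassesSpan (⨁ fun j : Fin N => A (π j)).X (⨁ fun j : Fin N => A (π j)).dim m :=
  hodgeClassSpan_prod_eq_divisorClassesSpan_of_partialConj
    (forall_exists_partialConj_pair_of_prime_of_finrank_inf_ne_two hp hp2 h01 hI h₀ h₁ hne h2) hΦ hA π m

/-- **`[L₀ ∩ L₁ : ℚ] ≠ 2`, PRIMITIVE types** (simple factors `A₀`, `A₁` of dimension `p`): the Hodge conjecture for every
`A₀^a × A₁^b`, UNCONDITIONALLY — primitive types in degree `2p` are nondegenerate (Yanai).
[cite: Yanai1985, §4 Theorem (p. 171)] [cite: Gordon1999HodgeAVSurvey, §3 Theorem, Thm. 6.3 Remark and 10.10] -/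
theorem hodgeConjectureFor_prod_pair_of_prime_of_isPrimitive {p : ℕ} (hp : p.Prime) (hp2 : p ≠ 2) {i₀ i₁ : I}
    (h01 : i₀ ≠ i₁) (hI : ∀ j, j = i₀ ∨ j = i₁) [IsGalois ℚ (K i₀)] [IsGalois ℚ (K i₁)]
    (h₀ : finrank ℚ (K i₀) = 2 * p) (h₁ : finrank ℚ (K i₁) = 2 * p)
    (hne : normalClosure ℚ (K i₀) ℂ ≠ normalClosure ℚ (K i₁) ℂ)
    (h2 : finrank ℚ ↥(normalClosure ℚ (K i₀) ℂ ⊓ normalClosure ℚ (K i₁) ℂ) ≠ 2)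
    (hprim : ∀ (i : I) (s₀ : K i →+* ℂ), IsPrimitive (ℂ ≃+* ℂ) (Φ i).1 s₀)
    (hA : ∀ i, IsCMTypeRealisation (Φ i) (A i) (ι i) (θ i)) {N : ℕ} (π : Fin N → I) :
    HodgeConjectureFor (⨁ fun j : Fin N => A (π j)).dim (⨁ fun j : Fin N => A (π j)).X := by
  refine hodgeConjectureFor_prod_pair_of_prime_of_finrank_inf_ne_two hp hp2 h01 hI h₀ h₁ hne h2 (fun i => ?_) hA π
  obtain ⟨φ₀⟩ : Nonempty (K i →+* ℂ) := inferInstance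
  have hdeg : finrank ℚ (K i) = 2 * p := by rcases hI i with rfl | rfl <;> assumption
  exact isNondegenerate_of_isPrimitive_of_prime hp hdeg φ₀ (hprim i φ₀)

/-- **`[L₀ ∩ L₁ : ℚ] = 2`: an exceptional Hodge class is FORCED.**  For a separating family (simple, pairwise
non-isogenous realisations) of two Galois CM fields of degree `2p`, `p` odd prime, whose closures meet in a quadratic
field, some product `⨁_{j<N} A_{π j}` carries a rational `(m,m)`-class outside `Dᵐ ⊗ ℂ` — the intersection is an
imaginary quadratic field `k` of odd relative degree `p` in both, and its Weil classes appear.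
[cite: Gordon1999HodgeAVSurvey, 7.5] [cite: Deligne1982HodgeCycles, §4] -/
theorem exists_exceptional_prod_pair_of_prime_of_finrank_inf_eq_two {p : ℕ} (hp : p.Prime) (hp2 : p ≠ 2)
    {i₀ i₁ : I} (h01 : i₀ ≠ i₁) [IsGalois ℚ (K i₀)] [IsGalois ℚ (K i₁)] (h₀ : finrank ℚ (K i₀) = 2 * p)
    (h₁ : finrank ℚ (K i₁) = 2 * p) (hsep : CMAlgebra.IsSeparatingFamily Φ)
    (h2 : finrank ℚ ↥(normalClosure ℚ (K i₀) ℂ ⊓ normalClosure ℚ (K i₁) ℂ) = 2)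
    (hA : ∀ i, IsCMTypeRealisation (Φ i) (A i) (ι i) (θ i)) :
    ∃ (N : ℕ) (π : Fin N → I) (m : ℕ) (c : complexBetti (⨁ fun j : Fin N => A (π j)).X (2 * m)),
      IsRationalClass c ∧
      IsOfHodgeType (⨁ fun j : Fin N => A (π j)).dim (⨁ fun j : Fin N => A (π j)).X (2 * m) m m c ∧
      c ∉ divisorClassesSpan (⨁ fun j : Fin N => A (π j)).X (⨁ fun j : Fin N => A (π j)).dim m :=
  CMAlgebra.exists_exceptional_prod_of_not_isNondegenerateFamily hsep
    (not_isNondegenerateFamily_of_prime_of_finrank_inf_eq_two hp hp2 h01 h₀ h₁ h2 Φ) hA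

/-- **`B• = D•` on every `A₀^a × A₁^b` iff `[L₀ ∩ L₁ : ℚ] ≠ 2`** — for a separating family of realisations of two Galois
CM fields of degree `2p` (`p` odd prime) with different closures, the single number `[L₀ ∩ L₁ : ℚ] ∈ {1, 2, p}` decides
whether all Hodge classes on all products are generated by divisors. [cite: Gordon1999HodgeAVSurvey, 7.5–7.7 and §3 Theorem] -/
theorem forall_prod_hodgeClassSpan_eq_iff_finrank_inf_ne_two_of_prime {p : ℕ} (hp : p.Prime) (hp2 : p ≠ 2)
    {i₀ i₁ : I} (h01 : i₀ ≠ i₁) (hI : ∀ j, j = i₀ ∨ j = i₁) [IsGalois ℚ (K i₀)] [IsGalois ℚ (K i₁)]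
    (h₀ : finrank ℚ (K i₀) = 2 * p) (h₁ : finrank ℚ (K i₁) = 2 * p)
    (hne : normalClosure ℚ (K i₀) ℂ ≠ normalClosure ℚ (K i₁) ℂ) (hsep : CMAlgebra.IsSeparatingFamily Φ)
    (hA : ∀ i, IsCMTypeRealisation (Φ i) (A i) (ι i) (θ i)) :
    (∀ (N : ℕ) (π : Fin N → I) (m : ℕ),
        hodgeClassSpan (⨁ fun j : Fin N => A (π j)).dim (⨁ fun j : Fin N => A (π j)).X m =
          divisorClassesSpan (⨁ fun j : Fin N => A (π j)).X (⨁ fun j : Fin N => A (π j)).dim m) ↔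
      finrank ℚ ↥(normalClosure ℚ (K i₀) ℂ ⊓ normalClosure ℚ (K i₁) ℂ) ≠ 2 := by
  have hdeg : ∀ i, finrank ℚ (K i) = 2 * p := fun i => by rcases hI i with rfl | rfl <;> assumption
  exact (CMAlgebra.isNondegenerateFamily_iff_forall_prod_hodgeClassSpan_eq hsep hA).symm.trans
    (isNondegenerateFamily_iff_finrank_inf_ne_two_of_prime hp hp2 h01 hI h₀ h₁ hne
      (isNondegenerate_of_isSeparatingFamily_of_prime hp hdeg hsep))

/-- **An exceptional Hodge class on some `A₀^a × A₁^b` iff `[L₀ ∩ L₁ : ℚ] = 2`** (separating family of realisations of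
two Galois CM fields of degree `2p`, `p` odd prime, different closures). [cite: Gordon1999HodgeAVSurvey, 7.5–7.7 and §3 Theorem]
[cite: Deligne1982HodgeCycles, §4] -/
theorem exists_exceptional_prod_iff_finrank_inf_eq_two_of_prime {p : ℕ} (hp : p.Prime) (hp2 : p ≠ 2)
    {i₀ i₁ : I} (h01 : i₀ ≠ i₁) (hI : ∀ j, j = i₀ ∨ j = i₁) [IsGalois ℚ (K i₀)] [IsGalois ℚ (K i₁)]
    (h₀ : finrank ℚ (K i₀) = 2 * p) (h₁ : finrank ℚ (K i₁) = 2 * p)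
    (hne : normalClosure ℚ (K i₀) ℂ ≠ normalClosure ℚ (K i₁) ℂ) (hsep : CMAlgebra.IsSeparatingFamily Φ)
    (hA : ∀ i, IsCMTypeRealisation (Φ i) (A i) (ι i) (θ i)) :
    (∃ (N : ℕ) (π : Fin N → I) (m : ℕ) (c : complexBetti (⨁ fun j : Fin N => A (π j)).X (2 * m)),
        IsRationalClass c ∧
        IsOfHodgeType (⨁ fun j : Fin N => A (π j)).dim (⨁ fun j : Fin N => A (π j)).X (2 * m) m m c ∧
        c ∉ divisorClassesSpan (⨁ fun j : Fin N => A (π j)).X (⨁ fun j : Fin N => A (π j)).dim m) ↔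
      finrank ℚ ↥(normalClosure ℚ (K i₀) ℂ ⊓ normalClosure ℚ (K i₁) ℂ) = 2 := by
  have hdeg : ∀ i, finrank ℚ (K i) = 2 * p := fun i => by rcases hI i with rfl | rfl <;> assumption
  refine ⟨?_, fun h2 => exists_exceptional_prod_pair_of_prime_of_finrank_inf_eq_two hp hp2 h01 h₀ h₁ hsep h2 hA⟩
  rintro ⟨N, π, m, c, hcQ, hcH, hcD⟩
  by_contra h2
  exact ((isNondegenerateFamily_iff_finrank_inf_ne_two_of_prime hp hp2 h01 hI h₀ h₁ hne
    (isNondegenerate_of_isSeparatingFamily_of_prime hp hdeg hsep)).2 h2).not_exists_exceptional_prod hA π m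
      ⟨c, hcQ, hcH, hcD⟩

/-- **The dichotomy for two simple, non-isogenous abelian varieties of odd prime dimension `p` with CM by non-isomorphic
GALOIS CM fields of degree `2p`.**  Let `A_{i₀}`, `A_{i₁}` be simple, not isogenous, realising CM types `Φ_i` of Galois
CM fields `K_i` with `[K_i : ℚ] = 2p` and `K_{i₀} ≇ K_{i₁}`.  Then EITHER the Hodge conjecture holds for every
`⨁_{j<N} A_{π j}` (every `A₀^a × A₁^b`) with `B• = D•` there — exactly when `[L₀ ∩ L₁ : ℚ] ≠ 2` — OR some such product
carries a rational `(m,m)`-class outside `Dᵐ ⊗ ℂ` — exactly when `[L₀ ∩ L₁ : ℚ] = 2`.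
[cite: Gordon1999HodgeAVSurvey, §3 Theorem, Thm. 6.3 Remark, 7.4–7.7 and 10.10] [cite: Yanai1985, §4 Theorem] -/
theorem hodgeConjectureFor_prod_or_exists_exceptional_of_isSimple_of_prime {p : ℕ} (hp : p.Prime) (hp2 : p ≠ 2)
    {i₀ i₁ : I} (h01 : i₀ ≠ i₁) (hI : ∀ j, j = i₀ ∨ j = i₁) [IsGalois ℚ (K i₀)] [IsGalois ℚ (K i₁)]
    (h₀ : finrank ℚ (K i₀) = 2 * p) (h₁ : finrank ℚ (K i₁) = 2 * p) (hKK : IsEmpty (K i₀ ≃+* K i₁))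
    (hA : ∀ i, IsCMTypeRealisation (Φ i) (A i) (ι i) (θ i)) (hs : ∀ i, (A i).IsSimple)
    (hniso : ∀ i j, i ≠ j → ¬ AbelianVariety.IsIsogenous (A i) (A j)) :
    (∀ (N : ℕ) (π : Fin N → I),
        HodgeConjectureFor (⨁ fun j : Fin N => A (π j)).dim (⨁ fun j : Fin N => A (π j)).X ∧
          ∀ m : ℕ, hodgeClassSpan (⨁ fun j : Fin N => A (π j)).dim (⨁ fun j : Fin N => A (π j)).X m =
            divisorClassesSpan (⨁ fun j : Fin N => A (π j)).X (⨁ fun j : Fin N => A (π j)).dim m) ∨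
      ∃ (N : ℕ) (π : Fin N → I) (m : ℕ) (c : complexBetti (⨁ fun j : Fin N => A (π j)).X (2 * m)),
        IsRationalClass c ∧
        IsOfHodgeType (⨁ fun j : Fin N => A (π j)).dim (⨁ fun j : Fin N => A (π j)).X (2 * m) m m c ∧
        c ∉ divisorClassesSpan (⨁ fun j : Fin N => A (π j)).X (⨁ fun j : Fin N => A (π j)).dim m := by
  have hsep : CMAlgebra.IsSeparatingFamily Φ :=
    CMAlgebra.isSeparatingFamily_of_isSimple_of_pairwise_not_isIsogenous hA hs hniso
  have hne : normalClosure ℚ (K i₀) ℂ ≠ normalClosure ℚ (K i₁) ℂ := normalClosure_ne_of_isEmpty_ringEquiv hKK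
  have hdeg : ∀ i, finrank ℚ (K i) = 2 * p := fun i => by rcases hI i with rfl | rfl <;> assumption
  have hΦ : ∀ i, IsNondegenerate (Φ i) := isNondegenerate_of_isSeparatingFamily_of_prime hp hdeg hsep
  by_cases h2 : finrank ℚ ↥(normalClosure ℚ (K i₀) ℂ ⊓ normalClosure ℚ (K i₁) ℂ) = 2
  · exact Or.inr (exists_exceptional_prod_pair_of_prime_of_finrank_inf_eq_two hp hp2 h01 h₀ h₁ hsep h2 hA)
  · exact Or.inl fun N π =>
      ⟨hodgeConjectureFor_prod_pair_of_prime_of_finrank_inf_ne_two hp hp2 h01 hI h₀ h₁ hne h2 hΦ hA π, fun m =>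
        hodgeClassSpan_prod_eq_divisorClassesSpan_pair_of_prime_of_finrank_inf_ne_two hp hp2 h01 hI h₀ h₁ hne h2
          hΦ hA π m⟩

/-- **Simple factors, `[L₀ ∩ L₁ : ℚ] ≠ 2`: the Hodge conjecture for every `A₀^a × A₁^b`** — two simple, non-isogenous
abelian varieties of odd prime dimension `p` with CM by non-isomorphic Galois CM fields of degree `2p` whose closures do
NOT meet in a quadratic field (e.g. `ℚ(ζ_7)` and `ℚ(√−3)·ℚ(ζ_7)⁺`, meeting in the real cubic `ℚ(ζ_7)⁺`; `ℚ(ζ_7)` and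
`ℚ(ζ_9)`, meeting in `ℚ`), UNCONDITIONALLY. [cite: Gordon1999HodgeAVSurvey, §3 Theorem, Thm. 6.3 Remark and 10.10]
[cite: Yanai1985, §4 Theorem] -/
theorem hodgeConjectureFor_prod_of_isSimple_of_prime_of_finrank_inf_ne_two {p : ℕ} (hp : p.Prime) (hp2 : p ≠ 2)
    {i₀ i₁ : I} (h01 : i₀ ≠ i₁) (hI : ∀ j, j = i₀ ∨ j = i₁) [IsGalois ℚ (K i₀)] [IsGalois ℚ (K i₁)]
    (h₀ : finrank ℚ (K i₀) = 2 * p) (h₁ : finrank ℚ (K i₁) = 2 * p) (hKK : IsEmpty (K i₀ ≃+* K i₁))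
    (h2 : finrank ℚ ↥(normalClosure ℚ (K i₀) ℂ ⊓ normalClosure ℚ (K i₁) ℂ) ≠ 2)
    (hA : ∀ i, IsCMTypeRealisation (Φ i) (A i) (ι i) (θ i)) (hs : ∀ i, (A i).IsSimple) {N : ℕ} (π : Fin N → I) :
    HodgeConjectureFor (⨁ fun j : Fin N => A (π j)).dim (⨁ fun j : Fin N => A (π j)).X := by
  refine hodgeConjectureFor_prod_pair_of_prime_of_isPrimitive hp hp2 h01 hI h₀ h₁
    (normalClosure_ne_of_isEmpty_ringEquiv hKK) h2 (fun i s₀ => ?_) hA π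
  exact (Literature.AlgebraicGeometry.ComplexMultiplication.isSimple_iff_isPrimitive (hA i) s₀).1 (hs i)

end Geometry

end Summit.HodgeConjecture.CorCM

end
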